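import Summits.CriticalPhenomena.PercolationContinuityZ3.Theorems.Transplant.FKConnectivityAllQAntipodalRootFormLevel3

/-!
# Connectivity correlation inequalities for `φ_{w,q}`, every `q > 0` — file 61Ω′: level 3 against EVERY ANTITONE LEVEL WEIGHT

Support file (`--supports stmt-CriticalPhenomena-4575`), FK sub-lane `prim-bschramm-fk-2` (gen 29); builds on p205010 (kernel theorem,
internal audit signed; external expert review pending).  No definitions, no named facts, no sorries; standard axioms.

`read3_total_eq_zero`: the antipodal form of a function `f` reading only `x, y, z` against a `g` blind to them has total mass `0`
(toggle the three specials: `γ ↦ γ ∆ {x,y,z}` reverses `f(γ∪C) − f(γᶜ∪C)` and fixes the `g`-factor) — the case `q = 1` (independence).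
`sum_antitone_mul_nonpos_of_levels_le`: ABEL BRIDGE for a general antitone weight `w` when the total is `0`:
`Σ_i w(e_i) a_i = Σ_{J<n} (w(J) − w(J+1))·Σ_{e_i ≤ J} a_i + w(n)·Σ_i a_i`.
`apPsiCW_read3_nonpos_of_isTTSP`: hence, in the setting of `apPsiC_levels_le_read3_nonpos_of_isTTSP` (file 61Ω), for EVERY antitone
`w : ℕ → ℝ`: `Σ_{γ} w(k(γ∪C)+k(γᶜ∪C))·(f(γ∪C) − f(γᶜ∪C))·(g(γ∪C) − g(γᶜ∪C)) ≤ 0` — Conjecture `C_∞⁺` at level 3 in its weighted form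
(every 2-connected series–parallel graph, every cell, every increasing `f` of three edges, every increasing `g` blind to them).
[cite: Grimmett2006, §3.8 Thm. (3.90) (pp. 61–62); §3.9 (pp. 63–64)] [cite: Wagner2006, Thm. 5.8(d), §5.3]
-/

noncomputable section

namespace Summit.CriticalPhenomena.PercolationContinuityZ3.Theorems

namespace FK

namespace RootForm

open SimpleGraph Finset Literature.Probability.LatticeModels Literature.Probability.Percolation
open scoped Classical symmDiff

variable {V : Type*} [Fintype V]

section Abel

/-- Telescoping against a general weight: for `e ≤ n`, `w e = w n + Σ_{J < n} 1{e ≤ J}·(w J − w (J+1))`. [folklore] -/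
theorem apply_eq_apply_add_sum_indicator (w : ℕ → ℝ) {e n : ℕ} (hen : e ≤ n) :
    w e = w n + ∑ J ∈ Finset.range n, (if e ≤ J then w J - w (J + 1) else 0) := by
  have key : ∑ J ∈ Finset.range n, (if e ≤ J then w J - w (J + 1) else 0) =
      ∑ J ∈ Finset.range n, (w (max e J) - w (max e (J + 1))) := by
    refine Finset.sum_congr rfl fun J _ => ?_
    by_cases h : e ≤ J
    · rw [if_pos h, max_eq_right h, max_eq_right (h.trans (Nat.le_succ J))]
    · rw [if_neg h]
      push Not at h
      rw [max_eq_left h.le, max_eq_left (Nat.succ_le_of_lt h), sub_self]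
  rw [key, Finset.sum_range_sub' (fun J => w (max e J)) n, max_eq_left (Nat.zero_le e), max_eq_right hen]
  ring

/-- **ABEL BRIDGE for antitone weights.**  If every level partial sum `Σ_{e(i) ≤ J} a_i` is `≤ 0` and the total `Σ_i a_i` is `0`, then
`Σ_i w(e(i))·a_i ≤ 0` for every antitone `w : ℕ → ℝ` (no sign condition on `w`). [folklore] -/
theorem sum_antitone_mul_nonpos_of_levels_le {ι : Type*} (s : Finset ι) (e : ι → ℕ) (a : ι → ℝ) (w : ℕ → ℝ)
    (hw : ∀ n : ℕ, w (n + 1) ≤ w n) (h : ∀ J : ℕ, ∑ i ∈ s with e i ≤ J, a i ≤ 0) (h0 : ∑ i ∈ s, a i = 0) :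
    ∑ i ∈ s, w (e i) * a i ≤ 0 := by
  set n := s.sup e with hn
  have hle : ∀ i ∈ s, e i ≤ n := fun i hi => Finset.le_sup hi
  have h1 : ∑ i ∈ s, w (e i) * a i =
      w n * ∑ i ∈ s, a i + ∑ J ∈ Finset.range n, (w J - w (J + 1)) * ∑ i ∈ s with e i ≤ J, a i := by
    have step : ∀ i ∈ s, w (e i) * a i =
        w n * a i + ∑ J ∈ Finset.range n, (w J - w (J + 1)) * (if e i ≤ J then a i else 0) := by
      intro i hi
      rw [apply_eq_apply_add_sum_indicator w (hle i hi), add_mul, Finset.sum_mul]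
      congr 1
      refine Finset.sum_congr rfl fun J _ => ?_
      split_ifs <;> ring
    rw [Finset.sum_congr rfl step, Finset.sum_add_distrib, ← Finset.mul_sum, Finset.sum_comm]
    congr 1
    refine Finset.sum_congr rfl fun J _ => ?_
    rw [Finset.sum_filter, Finset.mul_sum]
  rw [h1, h0, mul_zero, zero_add]
  refine Finset.sum_nonpos fun J _ => mul_nonpos_of_nonneg_of_nonpos ?_ (h J)
  linarith [hw J]

end Abel

section Total

variable {M' C : Finset (Sym2 V)} {x y z : Sym2 V}

omit [Fintype V] in
/-- **Total mass zero.**  For `f` reading only `x, y, z ∈ M'` (off `C`) and `g` blind to `x, y, z`, the full antipodal sum over `γ ⊆ M'` of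
`(f(γ∪C) − f((M'\\γ)∪C))·(g(γ∪C) − g((M'\\γ)∪C))` vanishes: the involution `γ ↦ γ ∆ {x,y,z}` reverses the first factor and fixes the second
(the case `q = 1`: `f` and `g` are independent under product measure). [folklore] -/
theorem read3_total_eq_zero (hxC : x ∉ C) (hyC : y ∉ C) (hzC : z ∉ C) (hxM : x ∈ M') (hyM : y ∈ M') (hzM : z ∈ M')
    {f : Finset (Sym2 V) → ℝ}
    (hf : ∀ A B : Finset (Sym2 V), (x ∈ A ↔ x ∈ B) → (y ∈ A ↔ y ∈ B) → (z ∈ A ↔ z ∈ B) → f A = f B)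
    {g : Finset (Sym2 V) → ℝ} (hgx : ∀ A : Finset (Sym2 V), g (insert x A) = g A)
    (hgy : ∀ A : Finset (Sym2 V), g (insert y A) = g A) (hgz : ∀ A : Finset (Sym2 V), g (insert z A) = g A) :
    ∑ γ ∈ M'.powerset, (f (γ ∪ C) - f (M' \ γ ∪ C)) * (g (γ ∪ C) - g (M' \ γ ∪ C)) = 0 := by
  set T : Finset (Sym2 V) := insert x {y, z} with hT
  have hxT : x ∈ T := Finset.mem_insert_self _ _
  have hyT : y ∈ T := Finset.mem_insert_of_mem (Finset.mem_insert_self _ _)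
  have hzT : z ∈ T := Finset.mem_insert_of_mem (Finset.mem_insert_of_mem (Finset.mem_singleton_self _))
  have hTM : T ⊆ M' := Finset.insert_subset hxM (Finset.insert_subset hyM (Finset.singleton_subset_iff.2 hzM))
  -- the two factors under the toggle
  have hF : ∀ γ : Finset (Sym2 V), f (γ ∆ T ∪ C) - f (M' \ (γ ∆ T) ∪ C) = -(f (γ ∪ C) - f (M' \ γ ∪ C)) := by
    intro γ
    have e1 : f (γ ∆ T ∪ C) = f (M' \ γ ∪ C) := by
      refine hf _ _ ?_ ?_ ?_ <;>
        simp only [Finset.mem_union, Finset.mem_symmDiff, Finset.mem_sdiff, hxT, hyT, hzT, hxC, hyC, hzC, hxM, hyM, hzM] <;> tauto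
    have e2 : f (M' \ (γ ∆ T) ∪ C) = f (γ ∪ C) := by
      refine hf _ _ ?_ ?_ ?_ <;>
        simp only [Finset.mem_union, Finset.mem_symmDiff, Finset.mem_sdiff, hxT, hyT, hzT, hxC, hyC, hzC, hxM, hyM, hzM] <;> tauto
    rw [e1, e2]
    ring
  have hG : ∀ γ : Finset (Sym2 V), g (γ ∆ T ∪ C) - g (M' \ (γ ∆ T) ∪ C) = g (γ ∪ C) - g (M' \ γ ∪ C) := by
    intro γ
    have u1 : γ ∆ T ∪ C ∪ T = γ ∪ C ∪ T := by
      ext e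
      simp only [Finset.mem_union, Finset.mem_symmDiff]
      tauto
    have u2 : M' \ (γ ∆ T) ∪ C ∪ T = M' \ γ ∪ C ∪ T := by
      ext e
      simp only [Finset.mem_union, Finset.mem_symmDiff, Finset.mem_sdiff]
      tauto
    rw [← blind3_union hgx hgy hgz (γ ∆ T ∪ C) T le_rfl, ← blind3_union hgx hgy hgz (γ ∪ C) T le_rfl, u1,
      ← blind3_union hgx hgy hgz (M' \ (γ ∆ T) ∪ C) T le_rfl, ← blind3_union hgx hgy hgz (M' \ γ ∪ C) T le_rfl, u2]
  refine Finset.sum_involution (fun γ _ => γ ∆ T) (fun γ _ => ?_) (fun γ _ hne => ?_) (fun γ hγ => ?_) (fun γ _ => ?_)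
  · rw [hF, hG]
    ring
  · intro heq
    rw [symmDiff_eq_left] at heq
    rw [heq] at hxT
    exact absurd hxT (Finset.notMem_empty _)
  · rw [Finset.mem_powerset] at hγ ⊢
    exact (symmDiff_le_sup (a := γ) (b := T)).trans (Finset.union_subset hγ hTM)
  · exact symmDiff_symmDiff_cancel_right T γ

end Total

section Weighted

variable {E M C : Finset (Sym2 V)} {a b uy vy uz vz : V}

/-- **CONJECTURE `C_∞⁺` AT LEVEL 3, WEIGHTED FORM.**  In the setting of `apPsiC_levels_le_read3_nonpos_of_isTTSP`, for EVERY antitone level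
weight `w : ℕ → ℝ`:
`Σ_{γ ⊆ M ∪ {x,y,z}} w(k(γ∪C)+k(γᶜ∪C))·(f(γ∪C) − f(γᶜ∪C))·(g(γ∪C) − g(γᶜ∪C)) ≤ 0`.
[cite: Grimmett2006, §3.8 Thm. (3.90) (pp. 61–62); §3.9 (pp. 63–64)] [cite: Wagner2006, Thm. 5.8(d), §5.3] -/
theorem apPsiCW_read3_nonpos_of_isTTSP (hE : IsTTSP E a b) (hx : s(a, b) ∉ E) (hy : s(uy, vy) ∈ E) (hz : s(uz, vz) ∈ E)
    (hyz : s(uy, vy) ≠ s(uz, vz)) (hM : M ⊆ (E.erase s(uy, vy)).erase s(uz, vz)) (hC : C ⊆ (E.erase s(uy, vy)).erase s(uz, vz))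
    (hMC : Disjoint M C)
    {f : Finset (Sym2 V) → ℝ}
    (hf : ∀ A B : Finset (Sym2 V), (s(a, b) ∈ A ↔ s(a, b) ∈ B) → (s(uy, vy) ∈ A ↔ s(uy, vy) ∈ B) →
      (s(uz, vz) ∈ A ↔ s(uz, vz) ∈ B) → f A = f B)
    (hfm : ∀ ⦃X Y : Finset (Sym2 V)⦄, X ⊆ Y → f X ≤ f Y)
    {w : ℕ → ℝ} (hw : ∀ n : ℕ, w (n + 1) ≤ w n)
    {g : Finset (Sym2 V) → ℝ} (hgx : ∀ A : Finset (Sym2 V), g (insert s(a, b) A) = g A)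
    (hgy : ∀ A : Finset (Sym2 V), g (insert s(uy, vy) A) = g A) (hgz : ∀ A : Finset (Sym2 V), g (insert s(uz, vz) A) = g A)
    (hmono : ∀ ⦃X Y : Finset (Sym2 V)⦄, X ⊆ Y → g X ≤ g Y) :
    ∑ γ ∈ (insert s(a, b) (insert s(uy, vy) (insert s(uz, vz) M))).powerset,
        w (apExpC (insert s(a, b) (insert s(uy, vy) (insert s(uz, vz) M))) C γ) *
          ((f (γ ∪ C) - f ((insert s(a, b) (insert s(uy, vy) (insert s(uz, vz) M))) \ γ ∪ C)) *
            (g (γ ∪ C) - g ((insert s(a, b) (insert s(uy, vy) (insert s(uz, vz) M))) \ γ ∪ C))) ≤ 0 := by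
  have hCe : C ⊆ E := hC.trans ((Finset.erase_subset _ _).trans (Finset.erase_subset _ _))
  have hyC : s(uy, vy) ∉ C := fun h => (Finset.mem_erase.1 (Finset.mem_of_mem_erase (hC h))).1 rfl
  have hzC : s(uz, vz) ∉ C := fun h => (Finset.mem_erase.1 (hC h)).1 rfl
  have hxC : s(a, b) ∉ C := fun h => hx (hCe h)
  refine sum_antitone_mul_nonpos_of_levels_le _ _ _ w hw
    (fun J => apPsiC_levels_le_read3_nonpos_of_isTTSP hE hx hy hz hyz hM hC hMC hf hfm hgx hgy hgz hmono J) ?_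
  exact read3_total_eq_zero hxC hyC hzC (Finset.mem_insert_self _ _) (Finset.mem_insert_of_mem (Finset.mem_insert_self _ _))
    (Finset.mem_insert_of_mem (Finset.mem_insert_of_mem (Finset.mem_insert_self _ _))) hf hgx hgy hgz

end Weighted

end RootForm

end FK

end Summit.CriticalPhenomena.PercolationContinuityZ3.Theorems

end
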